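import Summits.CriticalPhenomena.PercolationContinuityZ3.Theorems.PercNearOneGluingNoHeavyLowerTailCornerCILFamilies
import HarnessLib

/-!
# `NoHeavyLowerTail` (stmt-CriticalPhenomena-4575) — corner programme, layer 6a:
# guarded events, walk restriction, realizers of the guarded CIL event, and NO PRIVATE TRIPLE (guarded form)

GCIL_j (the lead's guarded form of CIL, memo LEAD-GEN2/3; "guarded = a giant exists elsewhere"):
`P(1 ≤ |π(o)| ≤ j, some cluster apart from C(o) holds > j relays) ≤ max_{a∈A} P(|π(a)| ≤ j, some cluster apart
from C(a) holds > j relays)`.  Here, for every finite weighted support, every `A`, every level `j`: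

the theorems are in layer 6b (`…CornerGCIL`: `Corner.leading_gcil_le`, `Corner.gcil_corner`).  This file: the guarded
events (`bigEvent`, `glightEvent`, `gcilEvent`), `mem_glight_of_light_of_heavy`, the walk-restriction lemma
`reachable_sdiff_bdry_of_avoids` (an open path avoiding `W` stays open when exactly `bdry W` is closed), the GUARDED
light-set bound `le_card_bdry_of_glight` (the guard is carried by a heavy open cluster avoiding `W`), the realizer
bookkeeping (`facts_of_mem_realizers_gcil`, up-families `upFamG`, `card_bdry_clus_of_mem_realizers_gcil`) and
`gcil_no_private_triple` (`…CutAntichain.cut_inter₃_eq_zero` exactly as in layer 5b, the heavy cluster of realizer `i`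
guarding every difference set inside `U_i`).  [folklore] bookkeeping; nothing about the crux is asserted.
-/

noncomputable section

namespace Summit.CriticalPhenomena.PercolationContinuityZ3.Theorems

open MeasureTheory Filter Topology Finset
open Literature.Probability.LatticeModels Literature.Probability.Percolation

namespace Corner

open scoped Classical

variable {V : Type*} [Fintype V] [DecidableEq V]

/-! ### The guarded events -/

/-- `{a giant apart from x}`: some relay `z`, not joined to `x`, whose cluster holds more than `j` relays. [folklore] -/
def bigEvent (A : Finset V) (j : ℕ) (x : V) : Set (BondConfig V) :=
  {ω | ∃ z ∈ A, ω ∉ openConn x z ∧ j < (A.filter fun y => ω ∈ openConn z y).card}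

/-- The guarded light event `{|π(x)| ≤ j} ∩ {a giant apart from x}`. [folklore] -/
def glightEvent (A : Finset V) (j : ℕ) (x : V) : Set (BondConfig V) := lightEvent A j x ∩ bigEvent A j x

/-- The guarded CIL event `{1 ≤ |π(o)| ≤ j} ∩ {a giant apart from o}`. [folklore] -/
def gcilEvent (A : Finset V) (j : ℕ) (o : V) : Set (BondConfig V) := cilEvent A j o ∩ bigEvent A j o

/-- A light vertex with a heavy RELAY elsewhere is guarded-light. [folklore] -/
theorem mem_glight_of_light_of_heavy {A : Finset V} {j : ℕ} {t t' : V} (ht' : t' ∈ A) {ω : BondConfig V}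
    (hl : ω ∈ lightEvent A j t) (hh : ω ∉ lightEvent A j t') : ω ∈ glightEvent A j t := by
  refine ⟨hl, t', ht', fun htt' => hh ?_, ?_⟩
  · simp only [lightEvent, Set.mem_setOf_eq, filter_openConn_eq_inter] at hl ⊢
    rwa [← clus_eq_of_reachable htt']
  · simp only [lightEvent, Set.mem_setOf_eq, not_le] at hh
    exact hh

/-! ### Walk restriction and the guarded light-set bound -/

omit [Fintype V] in
/-- An open path of `S ⊆ E` all of whose vertices avoid `W` is open in the configuration `E ∖ bdry W`. [folklore] -/
theorem reachable_sdiff_bdry_of_avoids {E S : Finset (Sym2 V)} (hSE : S ⊆ E) {W : Finset V} {z : V}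
    (hz : ∀ y, (openGraph (↑S : Set (Sym2 V))).Reachable z y → y ∉ W) {h : V}
    (hzh : (openGraph (↑S : Set (Sym2 V))).Reachable z h) :
    (openGraph (↑(E \ bdry E W) : Set (Sym2 V))).Reachable z h := by
  obtain ⟨p⟩ := hzh
  suffices key : ∀ {a c : V} (q : (openGraph (↑S : Set (Sym2 V))).Walk a c),
      (openGraph (↑S : Set (Sym2 V))).Reachable z a →
        (openGraph (↑(E \ bdry E W) : Set (Sym2 V))).Reachable a c from key p SimpleGraph.Reachable.rfl
  intro a c q
  induction q with
  | nil => exact fun _ => SimpleGraph.Reachable.rfl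
  | cons hadj q ih =>
    rename_i u v w
    intro hu
    have hv : (openGraph (↑S : Set (Sym2 V))).Reachable z v := hu.trans hadj.reachable
    have h1 := (openGraph_adj _ u v).1 hadj
    have hmem : s(u, v) ∈ E \ bdry E W := by
      rw [Finset.mem_sdiff]
      refine ⟨hSE (by exact_mod_cast h1.1), fun hb => ?_⟩
      rw [mem_bdry, crosses_mk_iff] at hb
      rcases hb.2 with ⟨huW, -⟩ | ⟨hvW, -⟩
      · exact hz u hu huW
      · exact hz v hv hvW
    have hadj' : (openGraph (↑(E \ bdry E W) : Set (Sym2 V))).Adj u v :=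
      (openGraph_adj _ u v).2 ⟨by exact_mod_cast hmem, h1.2⟩
    exact hadj'.reachable.trans (ih hv)

/-- **Guarded light-set bound.** If `{t light, giant apart}` has order `≥ m`, `W ∋ t` holds `≤ j` relays, and some
open cluster of an `S ⊆ E` avoids `W` and holds `> j` relays, then `W` has `≥ m` boundary pairs. [folklore] -/
theorem le_card_bdry_of_glight {E : Finset (Sym2 V)} {A : Finset V} {j m : ℕ} {t : V}
    (hm : ∀ T ∈ E.powerset, (↑T : Set (Sym2 V)) ∈ glightEvent A j t → m ≤ (E \ T).card)
    {W : Finset V} (ht : t ∈ W) (hW : (A ∩ W).card ≤ j)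
    {S : Finset (Sym2 V)} (hSE : S ⊆ E) {z : V} (hzA : z ∈ A)
    (hzW : ∀ y, (openGraph (↑S : Set (Sym2 V))).Reachable z y → y ∉ W)
    (hzj : j < (A ∩ clus (↑S : Set (Sym2 V)) z).card) : m ≤ (bdry E W).card := by
  have h := hm (E \ bdry E W) (Finset.mem_powerset.2 Finset.sdiff_subset) (by
    refine ⟨?_, z, hzA, fun htz => hzW z SimpleGraph.Reachable.rfl ?_, ?_⟩
    · simp only [lightEvent, Set.mem_setOf_eq, filter_openConn_eq_inter]
      exact (Finset.card_le_card (Finset.inter_subset_inter_left (clus_sdiff_bdry_subset E W ht))).trans hW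
    · exact clus_sdiff_bdry_subset E W ht (mem_clus.2 htz)
    · rw [filter_openConn_eq_inter]
      refine lt_of_lt_of_le hzj (Finset.card_le_card (Finset.inter_subset_inter_left fun y hy => ?_))
      exact mem_clus.2 (reachable_sdiff_bdry_of_avoids hSE hzW (mem_clus.1 hy)))
  rwa [card_sdiff_sdiff_bdry] at h

/-! ### Realizers of the guarded CIL event and their up-families -/

/-- What an order-`m` realizer of `gcil(o)` looks like. [folklore] -/
theorem facts_of_mem_realizers_gcil {E : Finset (Sym2 V)} {m : ℕ} {o : V} {A : Finset V} {j : ℕ}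
    {S : Finset (Sym2 V)} (hS : S ∈ realizers E (gcilEvent A j o) m) :
    S ⊆ E ∧ (E \ S).card = m ∧ 1 ≤ (A ∩ clus (↑S : Set (Sym2 V)) o).card ∧
      (A ∩ clus (↑S : Set (Sym2 V)) o).card ≤ j ∧
      ∃ z ∈ A, ¬ (openGraph (↑S : Set (Sym2 V))).Reachable o z ∧ j < (A ∩ clus (↑S : Set (Sym2 V)) z).card := by
  obtain ⟨hSE, hX, hcard⟩ := mem_realizers.1 hS
  obtain ⟨hcil, z, hzA, hoz, hzj⟩ := hX
  simp only [cilEvent, Set.mem_setOf_eq, filter_openConn_eq_inter] at hcil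
  rw [filter_openConn_eq_inter] at hzj
  exact ⟨hSE, hcard, hcil.1, hcil.2, z, hzA, hoz, hzj⟩

/-- The up-family of the relay `t` for GCIL: order-`m` realizers of `gcil(o)` whose `o`-cluster contains `t`. [folklore] -/
def upFamG (E : Finset (Sym2 V)) (m : ℕ) (o : V) (A : Finset V) (j : ℕ) (t : V) : Finset (Finset (Sym2 V)) :=
  (realizers E (gcilEvent A j o) m).filter fun S => t ∈ clus (↑S : Set (Sym2 V)) o

/-- Membership in the GCIL up-family. [folklore] -/
theorem mem_upFamG {E : Finset (Sym2 V)} {m : ℕ} {o : V} {A : Finset V} {j : ℕ} {t : V} {S : Finset (Sym2 V)} :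
    S ∈ upFamG E m o A j t ↔ S ∈ realizers E (gcilEvent A j o) m ∧ t ∈ clus (↑S : Set (Sym2 V)) o :=
  Finset.mem_filter

/-- For `S ∈ upFamG t`: support, `t` light, size, `t ↔ o`, and a giant relay apart from `o`. [folklore] -/
theorem upFamG_facts {E : Finset (Sym2 V)} {m : ℕ} {o : V} {A : Finset V} {j : ℕ} {t : V} {S : Finset (Sym2 V)}
    (hS : S ∈ upFamG E m o A j t) :
    S ⊆ E ∧ (A ∩ clus (↑S : Set (Sym2 V)) t).card ≤ j ∧ (E \ S).card = m ∧
      (openGraph (↑S : Set (Sym2 V))).Reachable t o ∧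
      ∃ z ∈ A, ¬ (openGraph (↑S : Set (Sym2 V))).Reachable o z ∧ j < (A ∩ clus (↑S : Set (Sym2 V)) z).card := by
  obtain ⟨hR, ht⟩ := mem_upFamG.1 hS
  obtain ⟨hSE, hcard, -, hj, hz⟩ := facts_of_mem_realizers_gcil hR
  have hto : (openGraph (↑S : Set (Sym2 V))).Reachable t o := (mem_clus.1 ht).symm
  refine ⟨hSE, ?_, hcard, hto, hz⟩
  rwa [clus_eq_of_reachable hto]

/-- The up-family lies in the realizer family of the guarded light event of its relay. [folklore] -/
theorem upFamG_subset (E : Finset (Sym2 V)) (m : ℕ) (o : V) (A : Finset V) (j : ℕ) (t : V) :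
    upFamG E m o A j t ⊆ realizers E (glightEvent A j t) m := by
  intro S hS
  obtain ⟨hSE, hj, hcard, hto, z, hzA, hoz, hzj⟩ := upFamG_facts hS
  refine mem_realizers.2 ⟨hSE, ⟨?_, z, hzA, fun htz => hoz (hto.symm.trans htz), ?_⟩, hcard⟩
  · simp only [lightEvent, Set.mem_setOf_eq, filter_openConn_eq_inter]; exact hj
  · rw [filter_openConn_eq_inter]; exact hzj

/-- Every order-`m` realizer of `gcil(o)` lies in the up-family of some relay. [folklore] -/
theorem exists_mem_upFamG {E : Finset (Sym2 V)} {m : ℕ} {o : V} {A : Finset V} {j : ℕ} {S : Finset (Sym2 V)}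
    (hS : S ∈ realizers E (gcilEvent A j o) m) : ∃ a ∈ A, a ∈ clus (↑S : Set (Sym2 V)) o ∧ S ∈ upFamG E m o A j a := by
  obtain ⟨-, -, h1, -, -⟩ := facts_of_mem_realizers_gcil hS
  obtain ⟨a, ha⟩ := Finset.card_pos.1 h1
  exact ⟨a, (Finset.mem_inter.1 ha).1, (Finset.mem_inter.1 ha).2, mem_upFamG.2 ⟨hS, (Finset.mem_inter.1 ha).2⟩⟩

/-- The `o`-cluster of an order-`m` realizer of `gcil(o)` has exactly `m` boundary pairs, provided the guarded light
events of the relays have order `≥ m`. [folklore] -/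
theorem card_bdry_clus_of_mem_realizers_gcil {E : Finset (Sym2 V)} {m : ℕ} {o : V} {A : Finset V} {j : ℕ}
    (hm : ∀ a ∈ A, ∀ T ∈ E.powerset, (↑T : Set (Sym2 V)) ∈ glightEvent A j a → m ≤ (E \ T).card)
    {S : Finset (Sym2 V)} (hS : S ∈ realizers E (gcilEvent A j o) m) :
    (bdry E (clus (↑S : Set (Sym2 V)) o)).card = m := by
  obtain ⟨hSE, hcard, h1, hj, z, hzA, hoz, hzj⟩ := facts_of_mem_realizers_gcil hS
  obtain ⟨a, ha⟩ := Finset.card_pos.1 h1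
  refine le_antisymm ((card_bdry_clus_le_card_sdiff o).trans hcard.le) ?_
  exact le_card_bdry_of_glight (hm a (Finset.mem_inter.1 ha).1) (Finset.mem_inter.1 ha).2 hj hSE hzA
    (fun y hzy hyU => hoz ((mem_clus.1 hyU).trans hzy.symm)) hzj

/-! ### No private triple (guarded) -/

/-- **No private triple, guarded form.** Three order-`m` realizers of `gcil(o)` cannot each contain a relay lying in
neither of the other two `o`-clusters, if every `{a light, giant apart}` has order `≥ m`. [folklore] (new here) -/
theorem gcil_no_private_triple (E : Finset (Sym2 V)) (m : ℕ) (o : V) (A : Finset V) (j : ℕ)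
    (hm : ∀ a ∈ A, ∀ T ∈ E.powerset, (↑T : Set (Sym2 V)) ∈ glightEvent A j a → m ≤ (E \ T).card)
    {S₁ S₂ S₃ : Finset (Sym2 V)} {a₁ a₂ a₃ : V}
    (hS₁ : S₁ ∈ realizers E (gcilEvent A j o) m) (hS₂ : S₂ ∈ realizers E (gcilEvent A j o) m)
    (hS₃ : S₃ ∈ realizers E (gcilEvent A j o) m) (ha₁ : a₁ ∈ A) (ha₂ : a₂ ∈ A) (ha₃ : a₃ ∈ A)
    (h₁ : a₁ ∈ clus (↑S₁ : Set (Sym2 V)) o) (h₁₂ : a₁ ∉ clus (↑S₂ : Set (Sym2 V)) o)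
    (h₁₃ : a₁ ∉ clus (↑S₃ : Set (Sym2 V)) o)
    (h₂ : a₂ ∈ clus (↑S₂ : Set (Sym2 V)) o) (h₂₁ : a₂ ∉ clus (↑S₁ : Set (Sym2 V)) o)
    (h₂₃ : a₂ ∉ clus (↑S₃ : Set (Sym2 V)) o)
    (h₃ : a₃ ∈ clus (↑S₃ : Set (Sym2 V)) o) (h₃₁ : a₃ ∉ clus (↑S₁ : Set (Sym2 V)) o)
    (h₃₂ : a₃ ∉ clus (↑S₂ : Set (Sym2 V)) o) : False := by
  obtain ⟨hE₁, -, -, hl₁, z₁, hz₁A, hoz₁, hz₁j⟩ := facts_of_mem_realizers_gcil hS₁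
  obtain ⟨hE₂, -, -, hl₂, z₂, hz₂A, hoz₂, hz₂j⟩ := facts_of_mem_realizers_gcil hS₂
  obtain ⟨hE₃, -, -, hl₃, z₃, hz₃A, hoz₃, hz₃j⟩ := facts_of_mem_realizers_gcil hS₃
  have hc₁ := card_bdry_clus_of_mem_realizers_gcil hm hS₁
  have hc₂ := card_bdry_clus_of_mem_realizers_gcil hm hS₂
  have hc₃ := card_bdry_clus_of_mem_realizers_gcil hm hS₃
  set U₁ := clus (↑S₁ : Set (Sym2 V)) o
  set U₂ := clus (↑S₂ : Set (Sym2 V)) o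
  set U₃ := clus (↑S₃ : Set (Sym2 V)) o
  -- the giant of realizer i avoids U_i, hence every W ⊆ U_i
  have av₁ : ∀ W ⊆ U₁, ∀ y, (openGraph (↑S₁ : Set (Sym2 V))).Reachable z₁ y → y ∉ W :=
    fun W hW y hzy hyW => hoz₁ ((mem_clus.1 (hW hyW)).trans hzy.symm)
  have av₂ : ∀ W ⊆ U₂, ∀ y, (openGraph (↑S₂ : Set (Sym2 V))).Reachable z₂ y → y ∉ W :=
    fun W hW y hzy hyW => hoz₂ ((mem_clus.1 (hW hyW)).trans hzy.symm)
  have av₃ : ∀ W ⊆ U₃, ∀ y, (openGraph (↑S₃ : Set (Sym2 V))).Reachable z₃ y → y ∉ W :=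
    fun W hW y hzy hyW => hoz₃ ((mem_clus.1 (hW hyW)).trans hzy.symm)
  have low : ∀ {a : V} {U W : Finset V} {S : Finset (Sym2 V)} {z : V}, a ∈ A → (A ∩ U).card ≤ j → W ⊆ U → a ∈ W →
      S ⊆ E → z ∈ A → (∀ y, (openGraph (↑S : Set (Sym2 V))).Reachable z y → y ∉ W) →
      j < (A ∩ clus (↑S : Set (Sym2 V)) z).card →
      (m : ℤ) ≤ ∑ u, ∑ v, if u ∈ W ∧ v ∈ Wᶜ then (↑(mult E u v) : ℤ) else 0 := by
    intro a U W S z ha hU hWU haW hSE hzA hzW hzj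
    rw [← card_bdry_eq_adj]
    have hW : (A ∩ W).card ≤ j := (Finset.card_le_card (Finset.inter_subset_inter le_rfl hWU)).trans hU
    exact_mod_cast le_card_bdry_of_glight (hm a ha) haW hW hSE hzA hzW hzj
  have eqm : ∀ {P : Finset V}, (bdry E P).card = m →
      (∑ u, ∑ v, if u ∈ P ∧ v ∈ Pᶜ then (↑(mult E u v) : ℤ) else 0) = (m : ℤ) := by
    intro P hP; rw [← card_bdry_eq_adj, hP]
  have d₁₂ : a₁ ∈ U₁ \ U₂ := Finset.mem_sdiff.2 ⟨h₁, h₁₂⟩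
  have d₁₃ : a₁ ∈ U₁ \ U₃ := Finset.mem_sdiff.2 ⟨h₁, h₁₃⟩
  have d₂₁ : a₂ ∈ U₂ \ U₁ := Finset.mem_sdiff.2 ⟨h₂, h₂₁⟩
  have d₂₃ : a₂ ∈ U₂ \ U₃ := Finset.mem_sdiff.2 ⟨h₂, h₂₃⟩
  have d₃₁ : a₃ ∈ U₃ \ U₁ := Finset.mem_sdiff.2 ⟨h₃, h₃₁⟩
  have d₃₂ : a₃ ∈ U₃ \ U₂ := Finset.mem_sdiff.2 ⟨h₃, h₃₂⟩
  have t₁ : a₁ ∈ U₁ \ (U₂ ∪ U₃) := Finset.mem_sdiff.2 ⟨h₁, by rw [Finset.mem_union, not_or]; exact ⟨h₁₂, h₁₃⟩⟩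
  have t₂ : a₂ ∈ U₂ \ (U₁ ∪ U₃) := Finset.mem_sdiff.2 ⟨h₂, by rw [Finset.mem_union, not_or]; exact ⟨h₂₁, h₂₃⟩⟩
  have t₃ : a₃ ∈ U₃ \ (U₁ ∪ U₂) := Finset.mem_sdiff.2 ⟨h₃, by rw [Finset.mem_union, not_or]; exact ⟨h₃₁, h₃₂⟩⟩
  have sd : ∀ (P Q : Finset V), P \ Q ⊆ P := fun P Q => Finset.sdiff_subset
  have hz := cut_inter₃_eq_zero (mult E) (mult_comm E) U₁ U₂ U₃ (m : ℤ) (eqm hc₁) (eqm hc₂) (eqm hc₃)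
    (low ha₁ hl₁ (sd _ _) d₁₂ hE₁ hz₁A (av₁ _ (sd _ _)) hz₁j) (low ha₂ hl₂ (sd _ _) d₂₁ hE₂ hz₂A (av₂ _ (sd _ _)) hz₂j)
    (low ha₁ hl₁ (sd _ _) d₁₃ hE₁ hz₁A (av₁ _ (sd _ _)) hz₁j) (low ha₃ hl₃ (sd _ _) d₃₁ hE₃ hz₃A (av₃ _ (sd _ _)) hz₃j)
    (low ha₂ hl₂ (sd _ _) d₂₃ hE₂ hz₂A (av₂ _ (sd _ _)) hz₂j) (low ha₃ hl₃ (sd _ _) d₃₂ hE₃ hz₃A (av₃ _ (sd _ _)) hz₃j)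
    (low ha₁ hl₁ (sd _ _) t₁ hE₁ hz₁A (av₁ _ (sd _ _)) hz₁j) (low ha₂ hl₂ (sd _ _) t₂ hE₂ hz₂A (av₂ _ (sd _ _)) hz₂j)
    (low ha₃ hl₃ (sd _ _) t₃ hE₃ hz₃A (av₃ _ (sd _ _)) hz₃j)
  set Z := U₁ ∩ U₂ ∩ U₃ with hZ
  have hZ0 : (bdry E Z).card = 0 := by
    have h := card_bdry_eq_adj E Z
    rw [hz] at h; exact_mod_cast h
  have hoZ : o ∈ Z := by
    simp only [hZ, Finset.mem_inter]
    exact ⟨⟨mem_clus.2 SimpleGraph.Reachable.rfl, mem_clus.2 SimpleGraph.Reachable.rfl⟩,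
      mem_clus.2 SimpleGraph.Reachable.rfl⟩
  have ha₁Z : a₁ ∈ Z := reachable_mem_of_card_bdry_eq_zero hE₁ hZ0 (mem_clus.1 h₁) hoZ
  exact h₁₂ (Finset.mem_inter.1 (Finset.mem_inter.1 ha₁Z).1).2

end Corner

end Summit.CriticalPhenomena.PercolationContinuityZ3.Theorems

end
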